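import Summits.CriticalPhenomena.PercolationContinuityZ3.Theses.PercNearOneGluing
import Summits.CriticalPhenomena.PercolationContinuityZ3.Theorems.PercNearOneGluingAdditiveGluingOneBond
import Literature.Probability.Percolation.PercolationEvents
import Literature.Probability.LatticeModels.ProdBernoulliIndependence
import Literature.Probability.LatticeModels.ProdBernoulliCoupling
import HarnessLib.Audit

/-! TTRL-lite variant V2379 of stmt-CriticalPhenomena-4574 -/

namespace Summit.CriticalPhenomena.PercolationContinuityZ3.Theorems

open MeasureTheory Set Literature.Probability.LatticeModels Literature.Probability.Percolation
open scoped Classical BigOperators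

/-- First step of an open path: if `x ↔ b` with `x ≠ b` then some pair `s(x, z)`, `z ≠ x`, is open.
[folklore] -/
theorem exists_mem_of_reachable_V2379 {V : Type*} {ω : Set (Sym2 V)} {x b : V}
    (h : (openGraph ω).Reachable x b) (hxb : x ≠ b) : ∃ z, z ≠ x ∧ s(x, z) ∈ ω := by
  obtain ⟨p⟩ := h
  cases p with
  | nil => exact absurd rfl hxb
  | cons hadj _ =>
    exact ⟨_, fun hz => ((openGraph_adj ω _ _).1 hadj).2 hz.symm, ((openGraph_adj ω _ _).1 hadj).1⟩

/-- An open pair joins its (distinct) endpoints. [folklore] -/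
theorem setOf_mem_subset_openConn_V2379 {V : Type*} {a c : V} (hac : a ≠ c) :
    {ω : Set (Sym2 V) | s(a, c) ∈ ω} ⊆ openConn a c :=
  fun ω hω => SimpleGraph.Adj.reachable ((openGraph_adj ω a c).2 ⟨hω, hac⟩)

/-- Two consecutive open pairs join the far endpoints. [folklore] -/
theorem inter_subset_openConn_V2379 {V : Type*} {a c d : V} (hac : a ≠ c) (hcd : c ≠ d) :
    ({ω : Set (Sym2 V) | s(a, c) ∈ ω} ∩ {ω | s(c, d) ∈ ω}) ⊆ openConn a d :=
  fun ω hω => (SimpleGraph.Adj.reachable ((openGraph_adj ω a c).2 ⟨hω.1, hac⟩)).trans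
    (SimpleGraph.Adj.reachable ((openGraph_adj ω c d).2 ⟨hω.2, hcd⟩))

/-- Intersecting with an event of probability one does not change the probability. [folklore] -/
theorem measureReal_inter_eq_of_eq_one_V2379 {Ω : Type*} [MeasurableSpace Ω] (μ : Measure Ω)
    [IsProbabilityMeasure μ] {S T : Set Ω} (hTm : MeasurableSet T) (hT : μ.real T = 1) :
    μ.real (S ∩ T) = μ.real S := by
  have h1 : μ T = 1 := (ENNReal.toReal_eq_one_iff _).1 hT
  have h2 : μ Tᶜ = 0 := (prob_compl_eq_zero_iff hTm).2 h1
  simp only [measureReal_def, measure_inter_conull h2]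

/-- Union bound at the source: on four vertices, `P(x ↔ b) ≤ w s(x,z₁) + w s(x,z₂) + w s(x,z₃)` when
every vertex other than `x` is one of `z₁, z₂, z₃` and `x ≠ b`. [folklore] -/
theorem real_openConn_le_three_V2379 (p : Sym2 (Fin 4) → unitInterval) {x b z₁ z₂ z₃ : Fin 4}
    (hxb : x ≠ b) (hcov : ∀ z, z ≠ x → z = z₁ ∨ z = z₂ ∨ z = z₃) :
    (prodBernoulli p).real (openConn x b) ≤ p s(x, z₁) + p s(x, z₂) + p s(x, z₃) := by
  have hsub : (openConn x b : Set (BondConfig (Fin 4))) ⊆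
      ({ω | s(x, z₁) ∈ ω} ∪ {ω | s(x, z₂) ∈ ω}) ∪ {ω | s(x, z₃) ∈ ω} := by
    intro ω hω
    have hω' : (openGraph ω).Reachable x b := hω
    obtain ⟨z, hz, hmem⟩ := exists_mem_of_reachable_V2379 hω' hxb
    rcases hcov z hz with rfl | rfl | rfl
    · exact Or.inl (Or.inl hmem)
    · exact Or.inl (Or.inr hmem)
    · exact Or.inr hmem
  calc (prodBernoulli p).real (openConn x b)
      ≤ (prodBernoulli p).real (({ω | s(x, z₁) ∈ ω} ∪ {ω | s(x, z₂) ∈ ω}) ∪ {ω | s(x, z₃) ∈ ω}) :=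
        measureReal_mono hsub
    _ ≤ (prodBernoulli p).real ({ω | s(x, z₁) ∈ ω} ∪ {ω | s(x, z₂) ∈ ω}) +
          (prodBernoulli p).real {ω | s(x, z₃) ∈ ω} := measureReal_union_le _ _
    _ ≤ ((prodBernoulli p).real {ω | s(x, z₁) ∈ ω} + (prodBernoulli p).real {ω | s(x, z₂) ∈ ω}) +
          (prodBernoulli p).real {ω | s(x, z₃) ∈ ω} := by
        gcongr
        exact measureReal_union_le _ _
    _ = p s(x, z₁) + p s(x, z₂) + p s(x, z₃) := by
        rw [prodBernoulli_real_setOf_mem, prodBernoulli_real_setOf_mem, prodBernoulli_real_setOf_mem]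

/-- Gluing: if the pair `s(v, y)` carries weight `1` then `P(y ↔ b) ≤ P(v ↔ b)`. [folklore] -/
theorem real_openConn_le_of_weight_one_V2379 (q : Sym2 (Fin 4) → unitInterval) {v y : Fin 4}
    (b : Fin 4) (hvy : v ≠ y) (hq : q s(v, y) = 1) :
    (prodBernoulli q).real (openConn y b) ≤ (prodBernoulli q).real (openConn v b) := by
  have hT : (prodBernoulli q).real {ω | s(v, y) ∈ ω} = 1 := by
    rw [prodBernoulli_real_setOf_mem, hq]; rfl
  rw [← measureReal_inter_eq_of_eq_one_V2379 (prodBernoulli q) (S := openConn y b)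
    (Set.toFinite _).measurableSet hT]
  refine measureReal_mono ?_
  rintro ω ⟨hyb, hvy'⟩
  have hyb' : (openGraph ω).Reachable y b := hyb
  exact (SimpleGraph.Adj.reachable ((openGraph_adj ω v y).2 ⟨hvy', hvy⟩)).trans hyb'

/-- Five elements of `Fin 4` cannot be pairwise distinct: with `v, x, b, y` distinct, every `z` is
one of them. [folklore] -/
theorem fin4_cover_V2379 : ∀ v x b y z : Fin 4, v ≠ x → v ≠ b → v ≠ y → x ≠ b → x ≠ y → b ≠ y →
    z = v ∨ z = x ∨ z = b ∨ z = y := by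
  decide

/-- Core of the case `x ∈ A` with both `s(v,x)` and `s(x,y)` of weight zero: from
`P_w(y ↔ b) ≤ P_w(x ↔ b)` deduce `P_{w[vx↦1]}(y ↔ b) ≤ P_{w[vx↦1]}(v ↔ b)` (one-bond decomposition
at `s(v,y)` plus union bounds at the sources). [folklore] -/
theorem shortening_core0_V2379 (w : Sym2 (Fin 4) → unitInterval) {v x b y : Fin 4}
    (hvx : v ≠ x) (hvb : v ≠ b) (hvy : v ≠ y) (hxb : x ≠ b) (hxy : x ≠ y) (hby : b ≠ y)
    (hwvx : w s(v, x) = 0) (hwxy : w s(x, y) = 0)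
    (hC : (prodBernoulli w).real (openConn y b) ≤ (prodBernoulli w).real (openConn x b)) :
    (prodBernoulli (Function.update w s(v, x) 1)).real (openConn y b) ≤
      (prodBernoulli (Function.update w s(v, x) 1)).real (openConn v b) := by
  have cov := fin4_cover_V2379 v x b y
  -- Step 1: `w s(y,b) ≤ w s(x,b)`
  have h53 : (w s(y, b) : ℝ) ≤ w s(x, b) := by
    have h1 : (w s(y, b) : ℝ) ≤ (prodBernoulli w).real (openConn y b) := by
      rw [← prodBernoulli_real_setOf_mem w s(y, b)]
      exact measureReal_mono (setOf_mem_subset_openConn_V2379 hby.symm)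
    have h2 : (prodBernoulli w).real (openConn x b) ≤ w s(x, b) + w s(x, y) + w s(x, v) :=
      real_openConn_le_three_V2379 w hxb fun z hz => by
        rcases cov z hvx hvb hvy hxb hxy hby with h | h | h | h
        · exact Or.inr (Or.inr h)
        · exact absurd h hz
        · exact Or.inl h
        · exact Or.inr (Or.inl h)
    have h3 : (w s(x, v) : ℝ) = 0 := by rw [Sym2.eq_swap, hwvx]; rfl
    have h4 : (w s(x, y) : ℝ) = 0 := by rw [hwxy]; rfl
    linarith
  -- Step 2: one-bond decomposition at `s(v, y)` under the glued weights
  set w1 := Function.update w s(v, x) 1 with hw1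
  have hne1 : s(v, y) ≠ s(v, x) := by
    intro h; rcases Sym2.eq_iff.1 h with ⟨_, h⟩ | ⟨h, _⟩
    · exact hxy h.symm
    · exact hvx h
  have hw1vy : w1 s(v, y) = w s(v, y) := by rw [hw1, Function.update_of_ne hne1]
  have hw1vx : w1 s(v, x) = 1 := by rw [hw1, Function.update_self]
  have dY := stub_oneBondDecomp_k15 4 w1 s(v, y) (openConn y b)
  have dV := stub_oneBondDecomp_k15 4 w1 s(v, y) (openConn v b)
  -- Step 3: doubly glued side
  have h11 : (prodBernoulli (Function.update w1 s(v, y) 1)).real (openConn y b) ≤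
      (prodBernoulli (Function.update w1 s(v, y) 1)).real (openConn v b) :=
    real_openConn_le_of_weight_one_V2379 _ b hvy (Function.update_self _ _ _)
  -- Step 4: side with `s(v, y)` closed
  set w10 := Function.update w1 s(v, y) 0 with hw10
  have hY10 : (prodBernoulli w10).real (openConn y b) ≤ w s(y, b) := by
    have h := real_openConn_le_three_V2379 w10 (x := y) (b := b) (z₁ := b) (z₂ := v) (z₃ := x)
      hby.symm fun z hz => by
        rcases cov z hvx hvb hvy hxb hxy hby with h | h | h | h
        · exact Or.inr (Or.inl h)
        · exact Or.inr (Or.inr h)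
        · exact Or.inl h
        · exact absurd h hz
    have e1 : w10 s(y, b) = w s(y, b) := by
      have n1 : s(y, b) ≠ s(v, y) := by
        intro h; rcases Sym2.eq_iff.1 h with ⟨h, _⟩ | ⟨_, h⟩
        · exact hvy h.symm
        · exact hvb h.symm
      have n2 : s(y, b) ≠ s(v, x) := by
        intro h; rcases Sym2.eq_iff.1 h with ⟨h, _⟩ | ⟨_, h⟩
        · exact hvy h.symm
        · exact hvb h.symm
      rw [hw10, Function.update_of_ne n1, hw1, Function.update_of_ne n2]
    have e2 : w10 s(y, v) = 0 := by rw [Sym2.eq_swap, hw10, Function.update_self]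
    have e3 : w10 s(y, x) = 0 := by
      have n1 : s(y, x) ≠ s(v, y) := by
        intro h; rcases Sym2.eq_iff.1 h with ⟨h, _⟩ | ⟨_, h⟩
        · exact hvy h.symm
        · exact hvx h.symm
      have n2 : s(y, x) ≠ s(v, x) := by
        intro h; rcases Sym2.eq_iff.1 h with ⟨h, _⟩ | ⟨_, h⟩
        · exact hvy h.symm
        · exact hvx h.symm
      rw [hw10, Function.update_of_ne n1, hw1, Function.update_of_ne n2, Sym2.eq_swap, hwxy]
    rw [e1, e2, e3] at h
    simpa using h
  have hV10 : (w s(x, b) : ℝ) ≤ (prodBernoulli w10).real (openConn v b) := by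
    have n1 : s(v, x) ≠ s(v, y) := hne1.symm
    have hvx10 : w10 s(v, x) = 1 := by rw [hw10, Function.update_of_ne n1, hw1vx]
    have hT : (prodBernoulli w10).real {ω | s(v, x) ∈ ω} = 1 := by
      rw [prodBernoulli_real_setOf_mem, hvx10]; rfl
    have e1 : w10 s(x, b) = w s(x, b) := by
      have n2 : s(x, b) ≠ s(v, y) := by
        intro h; rcases Sym2.eq_iff.1 h with ⟨h, _⟩ | ⟨_, h⟩
        · exact hvx h.symm
        · exact hvb h.symm
      have n3 : s(x, b) ≠ s(v, x) := by
        intro h; rcases Sym2.eq_iff.1 h with ⟨h, _⟩ | ⟨_, h⟩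
        · exact hvx h.symm
        · exact hvb h.symm
      rw [hw10, Function.update_of_ne n2, hw1, Function.update_of_ne n3]
    calc (w s(x, b) : ℝ) = w10 s(x, b) := by rw [e1]
      _ = (prodBernoulli w10).real {ω | s(x, b) ∈ ω} := (prodBernoulli_real_setOf_mem _ _).symm
      _ = (prodBernoulli w10).real ({ω | s(x, b) ∈ ω} ∩ {ω | s(v, x) ∈ ω}) :=
          (measureReal_inter_eq_of_eq_one_V2379 _ (Set.toFinite _).measurableSet hT).symm
      _ ≤ (prodBernoulli w10).real (openConn v b) := by
          refine measureReal_mono ?_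
          rintro ω ⟨hxb', hvx'⟩
          exact inter_subset_openConn_V2379 hvx hxb ⟨hvx', hxb'⟩
  -- Step 5: combine
  rw [dY, dV]
  have hq0 : 0 ≤ (w1 s(v, y) : ℝ) := (w1 s(v, y)).2.1
  have hq1 : (w1 s(v, y) : ℝ) ≤ 1 := (w1 s(v, y)).2.2
  exact add_le_add (mul_le_mul_of_nonneg_left (hY10.trans (h53.trans hV10)) (sub_nonneg.2 hq1))
    (mul_le_mul_of_nonneg_left h11 hq0)

/-- The case `x ∈ A`: from `P_w(y ↔ b) ≤ P_w(x ↔ b)` (with `w s(v,x) = 0`) deduce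
`P_{w[vx↦1]}(y ↔ b) ≤ P_{w[vx↦1]}(v ↔ b)`, by a one-bond decomposition at `s(x, y)` reducing to
`shortening_core0_V2379`. [folklore] -/
theorem shortening_core_V2379 (w : Sym2 (Fin 4) → unitInterval) {v x b y : Fin 4}
    (hvx : v ≠ x) (hvb : v ≠ b) (hvy : v ≠ y) (hxb : x ≠ b) (hxy : x ≠ y) (hby : b ≠ y)
    (hwvx : w s(v, x) = 0)
    (hC : (prodBernoulli w).real (openConn y b) ≤ (prodBernoulli w).real (openConn x b)) :
    (prodBernoulli (Function.update w s(v, x) 1)).real (openConn y b) ≤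
      (prodBernoulli (Function.update w s(v, x) 1)).real (openConn v b) := by
  set w1 := Function.update w s(v, x) 1 with hw1
  have hevx : s(x, y) ≠ s(v, x) := by
    intro h; rcases Sym2.eq_iff.1 h with ⟨h, _⟩ | ⟨_, h⟩
    · exact hvx h.symm
    · exact hvy h.symm
  have hw1e : w1 s(x, y) = w s(x, y) := by rw [hw1, Function.update_of_ne hevx]
  have hw1vx : w1 s(v, x) = 1 := by rw [hw1, Function.update_self]
  have dC1 := stub_oneBondDecomp_k15 4 w s(x, y) (openConn y b)
  have dC2 := stub_oneBondDecomp_k15 4 w s(x, y) (openConn x b)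
  have dG1 := stub_oneBondDecomp_k15 4 w1 s(x, y) (openConn y b)
  have dG2 := stub_oneBondDecomp_k15 4 w1 s(x, y) (openConn v b)
  -- glued sides
  have gC : (prodBernoulli (Function.update w s(x, y) 1)).real (openConn x b) ≤
      (prodBernoulli (Function.update w s(x, y) 1)).real (openConn y b) :=
    real_openConn_le_of_weight_one_V2379 _ b (Ne.symm hxy)
      (by rw [Sym2.eq_swap]; exact Function.update_self _ _ _)
  have gG : (prodBernoulli (Function.update w1 s(x, y) 1)).real (openConn y b) ≤
      (prodBernoulli (Function.update w1 s(x, y) 1)).real (openConn v b) :=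
    calc (prodBernoulli (Function.update w1 s(x, y) 1)).real (openConn y b)
        ≤ (prodBernoulli (Function.update w1 s(x, y) 1)).real (openConn x b) :=
          real_openConn_le_of_weight_one_V2379 _ b hxy (Function.update_self _ _ _)
      _ ≤ (prodBernoulli (Function.update w1 s(x, y) 1)).real (openConn v b) :=
          real_openConn_le_of_weight_one_V2379 _ b hvx
            (by rw [Function.update_of_ne hevx.symm, hw1vx])
  -- reduced weights
  set w0 := Function.update w s(x, y) 0 with hw0
  have hw0vx : w0 s(v, x) = 0 := by rw [hw0, Function.update_of_ne hevx.symm, hwvx]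
  have hw0xy : w0 s(x, y) = 0 := by rw [hw0, Function.update_self]
  have hcomm : Function.update w1 s(x, y) 0 = Function.update w0 s(v, x) 1 := by
    rw [hw1, hw0, Function.update_comm hevx.symm]
  have hq0 : 0 ≤ (w1 s(x, y) : ℝ) := (w1 s(x, y)).2.1
  have hq1 : (w1 s(x, y) : ℝ) ≤ 1 := (w1 s(x, y)).2.2
  by_cases he1 : (w s(x, y) : ℝ) = 1
  · rw [dG1, dG2, hw1e, he1, sub_self, zero_mul, zero_add, zero_mul, zero_add, one_mul, one_mul]
    exact gG
  · have hlt : (w s(x, y) : ℝ) < 1 := lt_of_le_of_ne (w s(x, y)).2.2 he1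
    have hC0 : (prodBernoulli w0).real (openConn y b) ≤ (prodBernoulli w0).real (openConn x b) := by
      rw [dC1, dC2] at hC
      have hpos : 0 < 1 - (w s(x, y) : ℝ) := sub_pos.2 hlt
      have key : (1 - (w s(x, y) : ℝ)) * (prodBernoulli w0).real (openConn y b) ≤
          (1 - (w s(x, y) : ℝ)) * (prodBernoulli w0).real (openConn x b) := by
        nlinarith [gC, (w s(x, y)).2.1]
      exact le_of_mul_le_mul_left key hpos
    have core := shortening_core0_V2379 w0 hvx hvb hvy hxb hxy hby hw0vx hw0xy hC0
    rw [← hcomm] at core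
    rw [dG1, dG2]
    exact add_le_add (mul_le_mul_of_nonneg_left core (sub_nonneg.2 hq1))
      (mul_le_mul_of_nonneg_left gG hq0)

/-- TTRL-lite variant V2379 (`n := 4`) of the shortening step of stmt-CriticalPhenomena-4574:
after gluing `v` to `x` (weight `1` on `s(v, x)`), `P(v ↔ A) · P(a₀ ↔ b) ≤ P(v ↔ b)` for the
`w`-minimiser `a₀` of `P(· ↔ b)` over `A`. On four vertices the induction hypothesis is not
needed: the cases `b ∈ {v, x}`, `a₀ = x`, `a₀ = b` are direct, `x ∉ A` is Harris' inequality, and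
`x ∈ A` is `shortening_core_V2379`. -/
theorem stub_shorteningStep_var2379 :
    ∀ (w : Sym2 (Fin 4) → unitInterval) (A : Finset (Fin 4)) (b v x a₀ : Fin 4), v ∉ A → v ≠ x →
      w s(v, x) = 0 → a₀ ∈ A →
      (∀ a ∈ A, (prodBernoulli w).real (openConn a₀ b) ≤ (prodBernoulli w).real (openConn a b)) →
      (∀ w' : Sym2 (Fin 4) → unitInterval, (∀ e, w e = 0 → w' e = 0) →
        ∀ (A' : Finset (Fin 4)) (o' b' : Fin 4) (t : ℝ),
          (∀ a ∈ A', t ≤ (prodBernoulli w').real (openConn a b')) →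
          (prodBernoulli w').real (⋃ a ∈ A', openConn o' a) * t ≤
            (prodBernoulli w').real (openConn o' b')) →
      (prodBernoulli (Function.update w s(v, x) 1)).real (⋃ a ∈ A, openConn v a) *
          (prodBernoulli (Function.update w s(v, x) 1)).real (openConn a₀ b) ≤
        (prodBernoulli (Function.update w s(v, x) 1)).real (openConn v b) := by
  intro w A b v x a₀ hvA hvx hwvx ha₀ hmin _
  set w1 := Function.update w s(v, x) 1 with hw1
  have hw1vx : w1 s(v, x) = 1 := by rw [hw1, Function.update_self]
  have hT : (prodBernoulli w1).real {ω | s(v, x) ∈ ω} = 1 := by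
    rw [prodBernoulli_real_setOf_mem, hw1vx]; rfl
  have hU1 : (prodBernoulli w1).real (⋃ a ∈ A, openConn v a) ≤ 1 := measureReal_le_one
  have hnn : 0 ≤ (prodBernoulli w1).real (openConn a₀ b) := measureReal_nonneg
  have hxv : (prodBernoulli w1).real (openConn x b) ≤ (prodBernoulli w1).real (openConn v b) :=
    real_openConn_le_of_weight_one_V2379 w1 b hvx hw1vx
  -- Case `b ∈ {v, x}`: the right-hand side is `1`.
  by_cases hbvx : b = v ∨ b = x
  · have h1 : (1 : ℝ) ≤ (prodBernoulli w1).real (openConn v b) := by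
      rw [← hT]
      refine measureReal_mono ?_
      intro ω hω
      change (openGraph ω).Reachable v b
      rcases hbvx with hb | hb
      · rw [hb]
      · rw [hb]; exact SimpleGraph.Adj.reachable ((openGraph_adj ω v x).2 ⟨hω, hvx⟩)
    calc (prodBernoulli w1).real (⋃ a ∈ A, openConn v a) * (prodBernoulli w1).real (openConn a₀ b)
        ≤ 1 * 1 := mul_le_mul hU1 measureReal_le_one hnn zero_le_one
      _ = 1 := one_mul 1
      _ ≤ _ := h1
  obtain ⟨hbv, hbx⟩ := not_or.1 hbvx
  -- Case `a₀ = x`.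
  by_cases hax : a₀ = x
  · calc (prodBernoulli w1).real (⋃ a ∈ A, openConn v a) * (prodBernoulli w1).real (openConn a₀ b)
        ≤ 1 * (prodBernoulli w1).real (openConn a₀ b) := mul_le_mul_of_nonneg_right hU1 hnn
      _ = (prodBernoulli w1).real (openConn a₀ b) := one_mul _
      _ ≤ _ := by rw [hax]; exact hxv
  -- Case `a₀ = b`: every relay is almost surely joined to `b`.
  by_cases hab : a₀ = b
  · have hle : w ≤ w1 := by
      intro e
      by_cases he : e = s(v, x)
      · rw [he, hw1vx]; exact Set.Icc.le_one
      · rw [hw1, Function.update_of_ne he]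
    have hall : ∀ a ∈ A, (prodBernoulli w1).real (openConn a b) = 1 := by
      intro a ha
      have huniv : (openConn b b : Set (BondConfig (Fin 4))) = Set.univ :=
        Set.eq_univ_of_forall fun ω => (SimpleGraph.Reachable.refl b : (openGraph ω).Reachable b b)
      have h1 : (prodBernoulli w).real (openConn a₀ b) = 1 := by
        rw [hab, huniv]; exact probReal_univ
      have h2 := hmin a ha
      rw [h1] at h2
      have h3 : (prodBernoulli w).real (openConn a b) ≤ (prodBernoulli w1).real (openConn a b) :=
        prodBernoulli_real_mono_of_isUpperSet hle (isUpperSet_openConn a b)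
          (Set.toFinite _).measurableSet
      exact le_antisymm measureReal_le_one (h2.trans h3)
    have hsub : (⋃ a ∈ A, openConn v a : Set (BondConfig (Fin 4))) ⊆
        openConn v b ∪ ⋃ a ∈ A, (openConn a b)ᶜ := by
      intro ω hω
      rw [Set.mem_iUnion₂] at hω
      obtain ⟨a, ha, hva⟩ := hω
      by_cases hab' : ω ∈ openConn a b
      · exact Or.inl ((hva : (openGraph ω).Reachable v a).trans hab')
      · exact Or.inr (Set.mem_iUnion₂.2 ⟨a, ha, hab'⟩)
    have hzero : ∀ a ∈ A, (prodBernoulli w1).real (openConn a b)ᶜ = 0 := by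
      intro a ha
      rw [probReal_compl_eq_one_sub (Set.toFinite _).measurableSet, hall a ha, sub_self]
    calc (prodBernoulli w1).real (⋃ a ∈ A, openConn v a) * (prodBernoulli w1).real (openConn a₀ b)
        ≤ (prodBernoulli w1).real (⋃ a ∈ A, openConn v a) * 1 :=
          mul_le_mul_of_nonneg_left measureReal_le_one measureReal_nonneg
      _ = (prodBernoulli w1).real (⋃ a ∈ A, openConn v a) := mul_one _
      _ ≤ (prodBernoulli w1).real (openConn v b ∪ ⋃ a ∈ A, (openConn a b)ᶜ) := measureReal_mono hsub
      _ ≤ (prodBernoulli w1).real (openConn v b) + (prodBernoulli w1).real (⋃ a ∈ A, (openConn a b)ᶜ) :=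
          measureReal_union_le _ _
      _ ≤ (prodBernoulli w1).real (openConn v b) + ∑ a ∈ A, (prodBernoulli w1).real (openConn a b)ᶜ := by
          gcongr
          exact measureReal_biUnion_finset_le _ _
      _ = (prodBernoulli w1).real (openConn v b) := by
          rw [Finset.sum_eq_zero hzero, add_zero]
  -- Main case: `v, x, b, a₀` pairwise distinct.
  have hav : a₀ ≠ v := fun h => hvA (h ▸ ha₀)
  by_cases hxA : x ∈ A
  · have core := shortening_core_V2379 w hvx (Ne.symm hbv) hav.symm (Ne.symm hbx) (Ne.symm hax)
      (Ne.symm hab) hwvx (hmin x hxA)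
    calc (prodBernoulli w1).real (⋃ a ∈ A, openConn v a) * (prodBernoulli w1).real (openConn a₀ b)
        ≤ 1 * (prodBernoulli w1).real (openConn a₀ b) := mul_le_mul_of_nonneg_right hU1 hnn
      _ = (prodBernoulli w1).real (openConn a₀ b) := one_mul _
      _ ≤ _ := core
  · -- `A ⊆ {b, a₀}`: Harris' inequality.
    have cov := fin4_cover_V2379 v x b a₀
    have hinc : (⋃ a ∈ A, openConn v a : Set (BondConfig (Fin 4))) ∩ openConn a₀ b ⊆ openConn v b := by
      rintro ω ⟨hω, hyb⟩
      rw [Set.mem_iUnion₂] at hω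
      obtain ⟨a, ha, hva⟩ := hω
      rcases cov a hvx (Ne.symm hbv) hav.symm (Ne.symm hbx) (Ne.symm hax) (Ne.symm hab)
        with h | h | h | h
      · exact absurd (h ▸ ha) hvA
      · exact absurd (h ▸ ha) hxA
      · exact h ▸ hva
      · exact (show (openGraph ω).Reachable v a₀ from h ▸ hva).trans hyb
    calc (prodBernoulli w1).real (⋃ a ∈ A, openConn v a) * (prodBernoulli w1).real (openConn a₀ b)
        ≤ (prodBernoulli w1).real ((⋃ a ∈ A, openConn v a) ∩ openConn a₀ b) :=
          prodBernoulli_harris w1 (isUpperSet_iUnion₂ fun a _ => isUpperSet_openConn v a)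
            (isUpperSet_openConn a₀ b) (Set.toFinite _).measurableSet (Set.toFinite _).measurableSet
      _ ≤ _ := measureReal_mono hinc

end Summit.CriticalPhenomena.PercolationContinuityZ3.Theorems
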